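import Literature.Probability.LatticeModels.DartPhase
import Literature.Probability.LatticeModels.DirichletGreenFunction
import Literature.Probability.RandomPlanarGeometry.PlanarDomains
import Summits.CriticalPhenomena.CardyFormulaZ2.Theorems.CardySusyWardParafermionPrecompactKenyonDefs
import Summits.CriticalPhenomena.CardyFormulaZ2.Theorems.CardySusyWardParafermionPrecompactSignedUmlaufsatz
import Literature.Probability.LatticeModels.LatticeLoopWinding
import Literature.Probability.LatticeModels.MedialCycleHopf

/-!
# Orientation of cycles of the turning rule via winding numbers of fine faces
# (helper for stub `stub_vertexRelation`)

Line `kenyon-stream-second-relation` of the crux `ParafermionPrecompact` (route `CardySusyWard`,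
item stmt-CriticalPhenomena-11293). A cycle of the turning rule `nextCorner β` (Smirnov's medial
loop of the loop representation) is coded, corner by corner, by the lattice points
`code (v, k) = 2v + w_k` of the tree's `RectLoop.code` (the affine image of the quarter-offset
points `v + (u_k + u_{k+1})/4` at which Smirnov rounds the loop, Ann. Math. 172 (2010), §4,
Fig. 5; `MedialCycleHopf.lean`); a cycle of minimal period `Q` becomes a SIMPLE closed lattice
walk `c : ClosedWalk Q` on the fine lattice (`coded_simple`, `three_le_period`), whose quarter
turns sum to the turn-sign sum of the cycle (`coded_sum_cross`). In the fine lattice the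
original vertex `v` owns the fine face `2v - (1,1)` (its four corners are the codes of the four
corners at `v`), the original face `f` owns the fine face `2f`, and every step of the coded walk
has an original vertex on its left and an original face on its right. Contents (all proved):

* `medialCycle_orientation_dichotomy` (registered helper): **turn-sign sum `+4` and right winding
  number `R = 0`, or `-4` and `R = -1`** (the signed Umlaufsatz `closedWalk_sum_cross_and_W_rf`
  of `…SignedUmlaufsatz.lean` transported along the code);
* `coded_W_fFace` / `coded_W_vFace`: the fine face of the face of every corner of the cycle has
  winding number `R`, the fine face of its vertex has `R + 1` (the two untaken forward fine edges
  at a code carry no traversal: `code_ne_code_nextCorner_add_dir`, `coded_W_sides_eq`);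
* transport lemmas for the eventual Jordan-domain argument: open lattice edges do not separate
  the fine faces of their endpoints (`coded_W_vFace_of_mem`: no cycle crosses an open edge), and a
  corner off the cycle does not separate the fine face of its vertex from that of its face
  (`coded_W_vFace_eq_fFace_of_notMem`: its code is unvisited).

No definition is introduced: the coded walk enters as a hypothesis `∀ m, c.v m = code (orb m)` on
an arbitrary `c : ClosedWalk Q`. References: S. Smirnov, Ann. of Math. 172 (2010), §4
[Smirnov2010]; H. Hopf, Compositio Math. 2 (1935), Satz I [Hopf1935].
-/

noncomputable section

namespace Summit.CriticalPhenomena.CardyFormulaZ2.Cruxes.ParafermionPrecompact.KenyonStreamSecondRelation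

open Finset
open _root_.Literature.Topology.PlaneTopology _root_.Literature.Topology.PlaneTopology.RectLoop
open _root_.Literature.Probability.LatticeModels
open _root_.Literature.Probability.Percolation (BondConfig)

/-! ## Coded cycles of the turning rule: orientation versus winding numbers of fine faces -/

section CodedCycle

open _root_.Literature.Topology.PlaneTopology.RectLoop (code codeOff dir cross)

/-! ### Steps of the turning rule in the corner code -/

variable {β : BondConfig (Site 2)}

/-- One step of the turning rule moves the code (so a corner is not its own successor).
[folklore] -/
theorem code_nextCorner_ne (p : Site 2 × Fin 4) : code (nextCorner β p) ≠ code p := by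
  obtain ⟨k, hk⟩ := exists_code_nextCorner (β := β) p
  rw [hk]
  intro h
  have : dir k = 0 := by simpa using h
  revert this; fin_cases k <;> simp [dir]

/-- **No immediate reversal**: the code of a corner is never one of the two forward neighbours
(`dir (k+1)`, `dir (k+2)`, `k` the face index of the successor) of the code of its successor —
two consecutive steps of the turning rule are never opposite. [folklore] -/
theorem code_ne_code_nextCorner_add_dir (p : Site 2 × Fin 4) {j : Fin 4}
    (hj : j = (nextCorner β p).2 + 1 ∨ j = (nextCorner β p).2 + 2) :
    code p ≠ code (nextCorner β p) + dir j := by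
  obtain ⟨v, k⟩ := p
  by_cases h : cTgt (v, k) ∈ β
  · rw [code_nextCorner_of_mem h]
    rw [nextCorner_of_mem h] at hj
    simp only at hj ⊢
    intro h'
    have h'' : dir (k + 1) + dir j = 0 := by
      have := congrArg (· - code (v, k)) h'; simpa [add_assoc] using this.symm
    rcases hj with rfl | rfl <;> revert h'' <;> fin_cases k <;> simp [dir]
  · rw [code_nextCorner_of_not_mem h]
    rw [nextCorner_of_not_mem h] at hj
    simp only at hj ⊢
    intro h'
    have h'' : dir (k + 2) + dir j = 0 := by
      have := congrArg (· - code (v, k)) h'; simpa [add_assoc] using this.symm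
    rcases hj with rfl | rfl <;> revert h'' <;> fin_cases k <;> simp [dir]

/-- Two steps of the turning rule do not return (no cycle has period `2`). [folklore] -/
theorem nextCorner_nextCorner_ne (p : Site 2 × Fin 4) : nextCorner β (nextCorner β p) ≠ p := by
  intro h
  obtain ⟨j, hj⟩ := exists_code_nextCorner (β := β) (nextCorner β p)
  rw [h] at hj
  have hj' : j = (nextCorner β p).2 + 1 ∨ j = (nextCorner β p).2 + 2 := by
    by_cases h1 : cTgt (nextCorner β p) ∈ β
    · have := code_nextCorner_of_mem h1
      rw [h, hj, add_right_inj] at this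
      exact Or.inl (by revert this; fin_cases j <;> generalize (nextCorner β p).2 = k <;> fin_cases k <;> simp [dir])
    · have := code_nextCorner_of_not_mem h1
      rw [h, hj, add_right_inj] at this
      exact Or.inr (by revert this; fin_cases j <;> generalize (nextCorner β p).2 = k <;> fin_cases k <;> simp [dir])
  exact code_ne_code_nextCorner_add_dir p hj' hj

/-- **The coded walk turns by `cross = (s + s')/2`**: twice the cross product of two consecutive
coded steps is the sum of the two turn signs (straight on where the medial loop alternates,
`±1` where two equal turns follow each other). [cite: Smirnov2010, §4 Fig. 5] -/
theorem two_mul_cross_code (p : Site 2 × Fin 4) :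
    2 * cross (code (nextCorner β p) - code p)
        (code (nextCorner β (nextCorner β p)) - code (nextCorner β p)) =
      turnSign β p + turnSign β (nextCorner β p) := by
  obtain ⟨v, k⟩ := p
  by_cases h1 : cTgt (v, k) ∈ β
  · rw [turnSign_of_mem h1]
    by_cases h2 : cTgt (nextCorner β (v, k)) ∈ β
    · rw [turnSign_of_mem h2, code_nextCorner_of_mem h2, add_sub_cancel_left, code_nextCorner_of_mem h1,
        add_sub_cancel_left, nextCorner_of_mem h1]
      fin_cases k <;> rfl
    · rw [turnSign_of_not_mem h2, code_nextCorner_of_not_mem h2, add_sub_cancel_left,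
        code_nextCorner_of_mem h1, add_sub_cancel_left, nextCorner_of_mem h1]
      fin_cases k <;> rfl
  · rw [turnSign_of_not_mem h1]
    by_cases h2 : cTgt (nextCorner β (v, k)) ∈ β
    · rw [turnSign_of_mem h2, code_nextCorner_of_mem h2, add_sub_cancel_left, code_nextCorner_of_not_mem h1,
        add_sub_cancel_left, nextCorner_of_not_mem h1]
      fin_cases k <;> rfl
    · rw [turnSign_of_not_mem h2, code_nextCorner_of_not_mem h2, add_sub_cancel_left,
        code_nextCorner_of_not_mem h1, add_sub_cancel_left, nextCorner_of_not_mem h1]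
      fin_cases k <;> rfl

/-! ### Fine faces: right faces of coded steps -/

/-- The face to the right of the FOLLOW step out of the corner `p = (v, k)` (direction `k + 1`)
is the fine face `2 f` of the face `f = cFace p` of the corner. [folklore] -/
theorem rf_code_follow (p : Site 2 × Fin 4) :
    ClosedWalk.rf (code p) (code p + dir (p.2 + 1)) = (2 * cFace p 0, 2 * cFace p 1) := by
  obtain ⟨v, k⟩ := p
  have hk : k = 0 ∨ k = 1 ∨ k = 2 ∨ k = 3 := by fin_cases k <;> simp
  rcases hk with rfl | rfl | rfl | rfl
  · rw [show ((0 : Fin 4) + 1) = 1 from rfl]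
    refine Prod.ext ?_ ?_ <;> simp [ClosedWalk.rf, code, codeOff, dir, cFace, faceAt, cornerOff]
  · rw [show ((1 : Fin 4) + 1) = 2 from rfl]
    refine Prod.ext ?_ ?_
    · simp [ClosedWalk.rf, code, codeOff, dir, cFace, faceAt, cornerOff]; omega
    · simp [ClosedWalk.rf, code, codeOff, dir, cFace, faceAt, cornerOff]
  · rw [show ((2 : Fin 4) + 1) = 3 from rfl]
    refine Prod.ext ?_ ?_ <;> simp [ClosedWalk.rf, code, codeOff, dir, cFace, faceAt, cornerOff] <;> omega
  · rw [show ((3 : Fin 4) + 1) = 0 from rfl]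
    refine Prod.ext ?_ ?_
    · simp [ClosedWalk.rf, code, codeOff, dir, cFace, faceAt, cornerOff]
    · simp [ClosedWalk.rf, code, codeOff, dir, cFace, faceAt, cornerOff]; omega

/-- The face to the left of the CROSS step out of `p = (v, k)` (direction `k + 2`; the right
face of the reversed step) is the fine face `2v - (1,1)` of the vertex `v`. [folklore] -/
theorem rf_code_cross_rev (p : Site 2 × Fin 4) :
    ClosedWalk.rf (code p + dir (p.2 + 2)) (code p) = (2 * p.1 0 - 1, 2 * p.1 1 - 1) := by
  obtain ⟨v, k⟩ := p
  have hk : k = 0 ∨ k = 1 ∨ k = 2 ∨ k = 3 := by fin_cases k <;> simp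
  rcases hk with rfl | rfl | rfl | rfl
  · rw [show ((0 : Fin 4) + 2) = 2 from rfl]
    refine Prod.ext ?_ ?_
    · simp [ClosedWalk.rf, code, codeOff, dir]; omega
    · simp [ClosedWalk.rf, code, codeOff, dir]
  · rw [show ((1 : Fin 4) + 2) = 3 from rfl]
    refine Prod.ext ?_ ?_ <;> simp [ClosedWalk.rf, code, codeOff, dir] <;> omega
  · rw [show ((2 : Fin 4) + 2) = 0 from rfl]
    refine Prod.ext ?_ ?_
    · simp [ClosedWalk.rf, code, codeOff, dir]
    · simp [ClosedWalk.rf, code, codeOff, dir]; omega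
  · rw [show ((3 : Fin 4) + 2) = 1 from rfl]
    refine Prod.ext ?_ ?_ <;> simp [ClosedWalk.rf, code, codeOff, dir]

/-- At a lattice point, the face to the left of direction `k + 1` is the face to the right of
direction `k + 2`. [folklore] -/
theorem rf_rev_eq (P : ℤ × ℤ) (k : Fin 4) :
    ClosedWalk.rf (P + dir (k + 1)) P = ClosedWalk.rf P (P + dir (k + 2)) := by
  obtain ⟨a, b⟩ := P
  have hk : k = 0 ∨ k = 1 ∨ k = 2 ∨ k = 3 := by fin_cases k <;> simp
  rcases hk with rfl | rfl | rfl | rfl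
  · rw [show ((0 : Fin 4) + 1) = 1 from rfl, show ((0 : Fin 4) + 2) = 2 from rfl]
    refine Prod.ext ?_ ?_ <;> simp [ClosedWalk.rf, dir]
  · rw [show ((1 : Fin 4) + 1) = 2 from rfl, show ((1 : Fin 4) + 2) = 3 from rfl]
    refine Prod.ext ?_ ?_
    · simp [ClosedWalk.rf, dir]; omega
    · simp [ClosedWalk.rf, dir]
  · rw [show ((2 : Fin 4) + 1) = 3 from rfl, show ((2 : Fin 4) + 2) = 0 from rfl]
    refine Prod.ext ?_ ?_
    · simp [ClosedWalk.rf, dir]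
    · simp [ClosedWalk.rf, dir]; omega
  · rw [show ((3 : Fin 4) + 1) = 0 from rfl, show ((3 : Fin 4) + 2) = 1 from rfl]
    refine Prod.ext ?_ ?_ <;> simp [ClosedWalk.rf, dir]

/-! ### Winding numbers across untraversed fine edges -/

/-- **Across an untraversed edge the two faces agree.** If neither traversal of the unit edge
`[P, P + dir j]` occurs in the closed walk, the faces on its two sides have the same winding
number. [folklore] -/
theorem W_sides_eq_of_cnt {n : ℕ} (c : ClosedWalk n) (P : ℤ × ℤ) (j : Fin 4)
    (h1 : c.cnt P (P + dir j) = 0) (h2 : c.cnt (P + dir j) P = 0) :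
    c.W (ClosedWalk.rf P (P + dir j)) = c.W (ClosedWalk.rf (P + dir j) P) := by
  obtain ⟨a, b⟩ := P
  have hj : j = 0 ∨ j = 1 ∨ j = 2 ∨ j = 3 := by fin_cases j <;> simp
  rcases hj with rfl | rfl | rfl | rfl
  · -- east
    have hd : ((a, b) : ℤ × ℤ) + dir 0 = (a + 1, b) := by simp [dir]
    rw [hd] at h1 h2 ⊢
    have hr : ClosedWalk.rf (a, b) (a + 1, b) = (a, b - 1) := by simp [ClosedWalk.rf]
    have hl : ClosedWalk.rf (a + 1, b) (a, b) = (a, b) := by simp [ClosedWalk.rf, Prod.ext_iff]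
    have e := c.W_succ_snd a (b - 1)
    rw [sub_add_cancel, c.cH_eq_cnt, h1, h2] at e
    rw [hr, hl, e]; ring
  · -- north
    have hd : ((a, b) : ℤ × ℤ) + dir 1 = (a, b + 1) := by simp [dir]
    rw [hd] at h1 h2 ⊢
    have hr : ClosedWalk.rf (a, b) (a, b + 1) = (a, b) := by simp [ClosedWalk.rf, Prod.ext_iff]
    have hl : ClosedWalk.rf (a, b + 1) (a, b) = (a - 1, b) := by simp [ClosedWalk.rf, Prod.ext_iff]
    have e := c.W_succ_fst (a - 1) b
    rw [sub_add_cancel, c.cV_eq_cnt, h1, h2] at e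
    rw [hr, hl, e]; ring
  · -- west
    have hd : ((a, b) : ℤ × ℤ) + dir 2 = (a - 1, b) := by simp [dir, sub_eq_add_neg]
    rw [hd] at h1 h2 ⊢
    have hr : ClosedWalk.rf (a, b) (a - 1, b) = (a - 1, b) := by
      simp [ClosedWalk.rf, Prod.ext_iff, sub_eq_add_neg]
    have hl : ClosedWalk.rf (a - 1, b) (a, b) = (a - 1, b - 1) := by
      simp [ClosedWalk.rf]
    have e := c.W_succ_snd (a - 1) (b - 1)
    rw [sub_add_cancel, c.cH_eq_cnt, sub_add_cancel, h1, h2] at e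
    rw [hr, hl, e]; ring
  · -- south
    have hd : ((a, b) : ℤ × ℤ) + dir 3 = (a, b - 1) := by simp [dir, sub_eq_add_neg]
    rw [hd] at h1 h2 ⊢
    have hr : ClosedWalk.rf (a, b) (a, b - 1) = (a - 1, b - 1) := by
      simp [ClosedWalk.rf, Prod.ext_iff, sub_eq_add_neg]
    have hl : ClosedWalk.rf (a, b - 1) (a, b) = (a, b - 1) := by
      simp [ClosedWalk.rf, Prod.ext_iff]
    have e := c.W_succ_fst (a - 1) (b - 1)
    rw [sub_add_cancel, c.cV_eq_cnt, sub_add_cancel, h1, h2] at e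
    rw [hr, hl, e]; ring

/-- **The four faces around an unvisited lattice point have equal winding numbers** (diagonal
pairs; the tree's `faceSum_eq_of_notMem` in the form needed here). [folklore] -/
theorem W_diag_eq_of_notMem {n : ℕ} (c : ClosedWalk n) {P : ℤ × ℤ} (h : ∀ j, c.v j ≠ P) :
    c.W (P.1 - 1, P.2 - 1) = c.W (P.1, P.2) ∧ c.W (P.1 - 1, P.2) = c.W (P.1, P.2 - 1) := by
  obtain ⟨a, b⟩ := P
  have h1 : c.W (a - 1, b) = c.W (a, b) := by
    have := c.W_succ_fst (a - 1) b
    rw [sub_add_cancel, c.cV_eq_zero_of_lower h, sub_zero] at this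
    exact this.symm
  have h2 : c.W (a, b - 1) = c.W (a, b) := by
    have := c.W_succ_snd a (b - 1)
    rw [sub_add_cancel, c.cH_eq_zero_of_left h, add_zero] at this
    exact this.symm
  have h3 : c.W (a - 1, b - 1) = c.W (a, b - 1) := by
    have := c.W_succ_fst (a - 1) (b - 1)
    rw [sub_add_cancel, c.cV_eq_zero_of_upper (by rw [sub_add_cancel]; exact h), sub_zero] at this
    exact this.symm
  exact ⟨h3.trans h2, h1.trans h2.symm⟩

/-! ### The coded closed walk of a cycle of the turning rule -/

variable {q : Site 2 × Fin 4} {Q : ℕ}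

/-- A cycle of minimal period `Q` of the turning rule codes a SIMPLE closed walk. [folklore] -/
theorem coded_simple (c : ClosedWalk Q) (hc : ∀ m, c.v m = code (cornerOrbit β q m)) (hQ0 : 0 < Q) (hQ : cornerOrbit β q Q = q)
    (hmin : ∀ s, 0 < s → s < Q → cornerOrbit β q s ≠ q) : c.Simple := by
  refine ⟨fun i j h => ?_⟩
  rw [hc, hc, ← cornerOrbit_mod_period hQ i, ← cornerOrbit_mod_period hQ j] at h
  have := cornerOrbit_window_injective hmin 0 (i := i % Q) (j := j % Q) (Nat.mod_lt _ hQ0) (Nat.mod_lt _ hQ0)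
    (by simpa using code_injective h)
  exact this

/-- Cycles of the turning rule have period at least `3`. [folklore] -/
theorem three_le_period (hQ0 : 0 < Q) (hQ : cornerOrbit β q Q = q) : 3 ≤ Q := by
  by_contra h
  have h12 : Q = 1 ∨ Q = 2 := by omega
  rcases h12 with rfl | rfl
  · exact code_nextCorner_ne (β := β) q (congrArg code hQ)
  · exact nextCorner_nextCorner_ne (β := β) q hQ

/-- **The turning of the coded walk is the turn-sign sum of the cycle.** [cite: Smirnov2010, §4 Fig. 5] -/
theorem coded_sum_cross (c : ClosedWalk Q) (hc : ∀ m, c.v m = code (cornerOrbit β q m)) (hQ : cornerOrbit β q Q = q) :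
    ∑ m ∈ Finset.range Q, cross (c.v (m + 1) - c.v m) (c.v (m + 2) - c.v (m + 1)) =
      ∑ m ∈ Finset.range Q, turnSign β (cornerOrbit β q m) := by
  have key : ∀ m, 2 * cross (c.v (m + 1) - c.v m) (c.v (m + 2) - c.v (m + 1)) =
      turnSign β (cornerOrbit β q m) + turnSign β (cornerOrbit β q (m + 1)) := by
    intro m
    rw [hc, hc, hc]
    exact two_mul_cross_code (cornerOrbit β q m)
  have h2 : 2 * ∑ m ∈ Finset.range Q, cross (c.v (m + 1) - c.v m) (c.v (m + 2) - c.v (m + 1)) =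
      2 * ∑ m ∈ Finset.range Q, turnSign β (cornerOrbit β q m) := by
    rw [Finset.mul_sum, Finset.sum_congr rfl fun m _ => key m, Finset.sum_add_distrib,
      sum_range_succ_of_periodic (g := fun m => turnSign β (cornerOrbit β q m))
        (by show turnSign β (cornerOrbit β q Q) = turnSign β (cornerOrbit β q 0); rw [hQ]; rfl)]
    ring
  linarith

/-- **Orientation dichotomy for cycles of the turning rule.** For a cycle of minimal period `Q`
of `nextCorner β` and its coded closed walk: either the turn signs sum to `4` and the right
winding number vanishes (counter-clockwise), or they sum to `-4` and the right winding number is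
`-1` (clockwise). (Registered helper of `stub_vertexRelation`.) [cite: Hopf1935, Satz I] -/
theorem medialCycle_orientation_dichotomy :
    ∀ (β : BondConfig (Site 2)) (q : Site 2 × Fin 4) (Q : ℕ), 0 < Q → cornerOrbit β q Q = q →
      (∀ s, 0 < s → s < Q → cornerOrbit β q s ≠ q) → ∀ c : ClosedWalk Q,
        (∀ m, c.v m = RectLoop.code (cornerOrbit β q m)) →
          (∑ m ∈ Finset.range Q, turnSign β (cornerOrbit β q m) = 4 ∧
              c.W (ClosedWalk.rf (c.v 0) (c.v 1)) = 0) ∨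
            (∑ m ∈ Finset.range Q, turnSign β (cornerOrbit β q m) = -4 ∧
              c.W (ClosedWalk.rf (c.v 0) (c.v 1)) = -1) := by
  intro β q Q hQ0 hQ hmin c hc
  rw [← coded_sum_cross c hc hQ]
  exact closedWalk_sum_cross_and_W_rf Q c (coded_simple c hc hQ0 hQ hmin) (three_le_period hQ0 hQ)

end CodedCycle

end Summit.CriticalPhenomena.CardyFormulaZ2.Cruxes.ParafermionPrecompact.KenyonStreamSecondRelation

end
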